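import Mathlib
import HarnessLib
import Summits.Ventures.LatticeQCDFlow.Scoring.DoeblinGreenKubo

/-!
# Doeblin by the invariant law: `L²(π)` contraction on centred observables and the
# cross-covariance envelope `|Cov_π(g(X₀), f(X_t))| ≤ (1 − ε)ᵗ σ_g σ_f`

HONEST FRAMING: exact (Metropolis-corrected) sampling algorithms for lattice gauge theory;
figures of merit are autocorrelation/cost numbers at stated couplings and volumes; no
continuum-physics claim.

Venture `LatticeQCDFlow` (cell pub-lqcd), topic `Scoring`; FANOUT row 8 (`s0-cpn-nemc`, GEN-12).
NEW WORK of the cell, not a published result: the BILINEAR form of the autocorrelation envelope of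
`Scoring/DoeblinAutocorrelation.lean` (`abs_autocov_le_of_doeblin`: `|∫ f·(kop κ)^[t] f dπ| ≤
(1 − ε)ᵗ ∫ f² dπ`), over the groundwork of `Scoring/KernelTransitionOperator.lean` (`kop`, the
residual-kernel action `iterate_kop_eq_of_centred`, Jensen, Cauchy–Schwarz) and
`Scoring/DoeblinGreenKubo.lean` (`iterate_kop_sub_const`).  Published input: only the residual
kernel of the tree's formalisation of Doeblin's theorem
(`Literature.Probability.MarkovChains.DoeblinMinorization`, Meyn–Tweedie 1993 Thm 16.2.4) through
its splitting, exactly as in the parent files; nothing is restated or cited as a fact.  Printed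
counterparts, NAMED ONLY: the `L²(π)` geometric-ergodicity / spectral-gap reading of a Doeblin
minorisation (Meyn–Tweedie 1993 Ch. 16; Roberts–Rosenthal 1997 §2 for reversible chains).

## Content (`κ` Markov with invariant probability law `π`; DOEBLIN BY `π` ITSELF:
## `κ(x, B) ≥ ε π(B)`; observables bounded measurable)

* `iterate_kop_eq_zero_of_doeblin_one` — the degenerate constant `ε = 1` forces `κ(x, ·) = π`, so a
  `π`-centred observable is killed after one step;
* **`integral_sq_iterate_kop_le_of_doeblin`** — `L²(π)` GEOMETRIC CONTRACTION with constant one: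
  `∫ ((kop κ)^[t] u)² dπ ≤ (1 − ε)^{2t} ∫ u² dπ` for every centred `u` (on centred observables the
  chain acts through `(1 − ε) · kop R` with `R` a `π`-invariant Markov kernel, and `kop R` is an
  `L²(π)` contraction by Jensen + invariance) — the operator norm of `(kop κ)ᵗ` on `L²₀(π)` is at
  most `(1 − ε)ᵗ`, no reversibility;
* **`abs_integral_mul_iterate_kop_le_of_doeblin`** — THE BILINEAR ENVELOPE: for centred `u` and ANY
  bounded measurable `g`, `|∫ g · (kop κ)^[t] u dπ| ≤ (1 − ε)ᵗ · √(∫ g² dπ) · √(∫ u² dπ)`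
  (Cauchy–Schwarz on the contraction);
* **`abs_crossCov_le_of_doeblin`** — in covariance form for two arbitrary bounded measurable
  observables: `|∫ g · (kop κ)^[t] f dπ − π(g) π(f)| ≤ (1 − ε)ᵗ · σ_π(g) · σ_π(f)` with
  `σ_π(h)² = ∫ (h − π(h))² dπ` — the stationary cross-covariance `Cov_π(g(X₀), f(X_t))` of every
  pair of bounded observables decays at the Doeblin rate with constant ONE;
* `abs_crossCov_le_exp_of_doeblin` — the same with `ε = e^{−M}` (the shape delivered by the tree's
  exact flow-MCMC theorems, `Exactness/ApproxTrivializingSampler.lean`; `M = 2δ` for a flow-equation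
  defect `δ`): `|Cov_π(g(X₀), f(X_t))| ≤ (1 − e^{−M})ᵗ σ_π(g) σ_π(f)`.

Reading (value-free): cross-correlations between DIFFERENT observables along the chain (e.g. the
topological charge now and the plaquette `t` updates later) obey the same certified envelope as
autocorrelations; the diagonal case `g = f` centred is `abs_autocov_le_of_doeblin` again.  NOT
CLAIMED: unbounded observables; any number of ours; estimator statements.
-/

noncomputable section

namespace Summit.Ventures.LatticeQCDFlow.Scoring

open MeasureTheory ProbabilityTheory Filter Literature.Probability.MarkovChains
open scoped ENNReal

variable {Ω : Type*} [MeasurableSpace Ω]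

section CrossCovariance

variable {κ : Kernel Ω Ω} [IsMarkovKernel κ] {π : Measure Ω} [IsProbabilityMeasure π] {ε : ℝ≥0∞}

/-- The degenerate Doeblin constant `ε = 1`: then `κ(x, ·) = π` for every `x`, and every bounded
measurable `π`-centred observable is killed after one step, `(kop κ)^[t+1] u = 0`. -/
theorem iterate_kop_eq_zero_of_doeblin_one
    (hmin : ∀ x {B : Set Ω}, MeasurableSet B → (1 : ℝ≥0∞) * π B ≤ κ x B) {u : Ω → ℝ}
    (hu0 : ∫ x, u x ∂π = 0) (t : ℕ) : (kop κ)^[t + 1] u = fun _ => 0 := by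
  have hKπ : ∀ x, κ x = π := fun x => by
    ext B hB
    refine le_antisymm ?_ (by simpa using hmin x hB)
    have hc : π Bᶜ ≤ κ x Bᶜ := by simpa using hmin x hB.compl
    rw [prob_compl_eq_one_sub hB, prob_compl_eq_one_sub hB] at hc
    exact (ENNReal.sub_le_sub_iff_left prob_le_one ENNReal.one_ne_top).1 hc
  have hku : kop κ u = fun _ => 0 := by
    funext x
    unfold kop
    rw [hKπ x, hu0]
  have hzero : ∀ s : ℕ, (kop κ)^[s] (fun _ : Ω => (0 : ℝ)) = fun _ => 0 := by
    intro s
    induction s with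
    | zero => rfl
    | succ s ih =>
      rw [Function.iterate_succ_apply', ih]
      funext x
      simp [kop]
  rw [Function.iterate_succ_apply, hku, hzero]

/-- **`L²(π)` GEOMETRIC CONTRACTION ON CENTRED OBSERVABLES (constant one).**  If `π` is an invariant
probability law of the Markov kernel `κ` and `κ(x, B) ≥ ε π(B)` for all `x` and measurable `B`, then
for every bounded measurable `π`-centred `u` and every `t`:
`∫ ((kop κ)^[t] u)² dπ ≤ (1 − ε)^{2t} · ∫ u² dπ`. -/
theorem integral_sq_iterate_kop_le_of_doeblin (hπ : Kernel.Invariant κ π)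
    (hmin : ∀ x {B : Set Ω}, MeasurableSet B → ε * π B ≤ κ x B) {u : Ω → ℝ} (hu : Measurable u)
    {C : ℝ} (hC : ∀ x, |u x| ≤ C) (hu0 : ∫ x, u x ∂π = 0) (t : ℕ) :
    ∫ x, ((kop κ)^[t] u x) ^ 2 ∂π ≤ (1 - ε.toReal) ^ (2 * t) * ∫ x, u x ^ 2 ∂π := by
  have hε1 : ε ≤ 1 := eps_le_one_of_doeblin hmin
  have hu2 : 0 ≤ ∫ x, u x ^ 2 ∂π := integral_nonneg fun x => sq_nonneg _
  rcases eq_or_lt_of_le hε1 with h1 | hε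
  · subst h1
    cases t with
    | zero => simp
    | succ t =>
      rw [iterate_kop_eq_zero_of_doeblin_one hmin hu0 t, ENNReal.toReal_one, sub_self,
        zero_pow (by omega : 2 * (t + 1) ≠ 0), zero_mul]
      simp
  · haveI := Doeblin.isMarkovKernel_residualKernel (κ := κ) (ν := π) (hmin := hmin) hε
    have hR := iterate_kop_eq_of_centred (hmin := hmin) hπ hε hu hC hu0 t
    have hRle := integral_sq_iterate_kop_le (Doeblin.residualKernel κ π ε hmin)
      (invariant_residualKernel hπ hε) hu hC t
    have hεr : (1 - ε).toReal = 1 - ε.toReal := by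
      rw [ENNReal.toReal_sub_of_le hε1 ENNReal.one_ne_top, ENNReal.toReal_one]
    have hc0 : 0 ≤ 1 - ε.toReal := one_sub_toReal_nonneg_of_doeblin hmin
    have heq : ∫ x, ((kop κ)^[t] u x) ^ 2 ∂π
        = (1 - ε.toReal) ^ (2 * t) *
            ∫ x, ((kop (Doeblin.residualKernel κ π ε hmin))^[t] u x) ^ 2 ∂π := by
      rw [hR, ← integral_const_mul]
      refine integral_congr_ae (ae_of_all _ fun x => ?_)
      show ((1 - ε).toReal ^ t * (kop (Doeblin.residualKernel κ π ε hmin))^[t] u x) ^ 2 = _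
      rw [hεr, pow_mul']
      ring
    rw [heq]
    exact mul_le_mul_of_nonneg_left hRle (pow_nonneg hc0 _)

/-- **THE BILINEAR ENVELOPE.**  For a bounded measurable `π`-centred `u` and ANY bounded measurable
`g`: `|∫ g · (kop κ)^[t] u dπ| ≤ (1 − ε)ᵗ · √(∫ g² dπ) · √(∫ u² dπ)` (Cauchy–Schwarz on the `L²(π)`
contraction; no reversibility). -/
theorem abs_integral_mul_iterate_kop_le_of_doeblin (hπ : Kernel.Invariant κ π)
    (hmin : ∀ x {B : Set Ω}, MeasurableSet B → ε * π B ≤ κ x B) {g u : Ω → ℝ} (hg : Measurable g)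
    {Cg : ℝ} (hCg : ∀ x, |g x| ≤ Cg) (hu : Measurable u) {Cu : ℝ} (hCu : ∀ x, |u x| ≤ Cu)
    (hu0 : ∫ x, u x ∂π = 0) (t : ℕ) :
    |∫ x, g x * (kop κ)^[t] u x ∂π|
      ≤ (1 - ε.toReal) ^ t * (Real.sqrt (∫ x, g x ^ 2 ∂π) * Real.sqrt (∫ x, u x ^ 2 ∂π)) := by
  obtain ⟨hm, hb⟩ := iterate_kop_bounded_measurable κ hu hCu t
  have hcs := sq_integral_mul_le π hg hm hCg hb
  have hcontr := integral_sq_iterate_kop_le_of_doeblin hπ hmin hu hCu hu0 t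
  have hc0 : 0 ≤ 1 - ε.toReal := one_sub_toReal_nonneg_of_doeblin hmin
  have hg2 : 0 ≤ ∫ x, g x ^ 2 ∂π := integral_nonneg fun x => sq_nonneg _
  have hu2 : 0 ≤ ∫ x, u x ^ 2 ∂π := integral_nonneg fun x => sq_nonneg _
  have hsq : (∫ x, g x * (kop κ)^[t] u x ∂π) ^ 2
      ≤ ((1 - ε.toReal) ^ t * (Real.sqrt (∫ x, g x ^ 2 ∂π) * Real.sqrt (∫ x, u x ^ 2 ∂π))) ^ 2 := by
    calc (∫ x, g x * (kop κ)^[t] u x ∂π) ^ 2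
        ≤ (∫ x, g x ^ 2 ∂π) * ∫ x, ((kop κ)^[t] u x) ^ 2 ∂π := hcs
      _ ≤ (∫ x, g x ^ 2 ∂π) * ((1 - ε.toReal) ^ (2 * t) * ∫ x, u x ^ 2 ∂π) :=
          mul_le_mul_of_nonneg_left hcontr hg2
      _ = ((1 - ε.toReal) ^ t * (Real.sqrt (∫ x, g x ^ 2 ∂π) * Real.sqrt (∫ x, u x ^ 2 ∂π))) ^ 2 := by
          rw [mul_pow, mul_pow, Real.sq_sqrt hg2, Real.sq_sqrt hu2, ← pow_mul, mul_comm 2 t]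
          ring
  exact abs_le_of_sq_le_sq hsq
    (mul_nonneg (pow_nonneg hc0 t) (mul_nonneg (Real.sqrt_nonneg _) (Real.sqrt_nonneg _)))

/-- **THE CROSS-COVARIANCE ENVELOPE.**  For ANY two bounded measurable observables `f, g` of a
Markov kernel with invariant probability law `π` and `κ(x, ·) ≥ ε π`:
`|∫ g · (kop κ)^[t] f dπ − π(g) π(f)| ≤ (1 − ε)ᵗ · σ_π(g) · σ_π(f)`, where
`σ_π(h) = √(∫ (h − π(h))² dπ)` — the stationary cross-covariance `Cov_π(g(X₀), f(X_t))` decays at the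
Doeblin rate with constant one. -/
theorem abs_crossCov_le_of_doeblin (hπ : Kernel.Invariant κ π)
    (hmin : ∀ x {B : Set Ω}, MeasurableSet B → ε * π B ≤ κ x B) {f g : Ω → ℝ} (hf : Measurable f)
    {Cf : ℝ} (hCf : ∀ x, |f x| ≤ Cf) (hg : Measurable g) {Cg : ℝ} (hCg : ∀ x, |g x| ≤ Cg) (t : ℕ) :
    |∫ x, g x * (kop κ)^[t] f x ∂π - (∫ x, g x ∂π) * ∫ x, f x ∂π|
      ≤ (1 - ε.toReal) ^ t *
          (Real.sqrt (∫ x, (g x - ∫ y, g y ∂π) ^ 2 ∂π)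
            * Real.sqrt (∫ x, (f x - ∫ y, f y ∂π) ^ 2 ∂π)) := by
  -- the centred observables `u = f − π(f)`, `v = g − π(g)`
  set a := ∫ y, f y ∂π with ha
  set b := ∫ y, g y ∂π with hb
  have hfi : Integrable f π := integrable_of_bounded π hf hCf
  have hgi : Integrable g π := integrable_of_bounded π hg hCg
  have hum : Measurable fun x => f x - a := hf.sub measurable_const
  have hvm : Measurable fun x => g x - b := hg.sub measurable_const
  have hub : ∀ x, |f x - a| ≤ Cf + |a| := fun x =>
    (abs_sub _ _).trans (add_le_add (hCf x) le_rfl)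
  have hvb : ∀ x, |g x - b| ≤ Cg + |b| := fun x =>
    (abs_sub _ _).trans (add_le_add (hCg x) le_rfl)
  have hu0 : ∫ x, (f x - a) ∂π = 0 := by
    rw [integral_sub hfi (integrable_const a), integral_const, probReal_univ, one_smul, ha, sub_self]
  -- `(kop κ)^[t] f = (kop κ)^[t] u + a`
  have hshift := iterate_kop_sub_const (κ := κ) hf hCf a t
  obtain ⟨hKum, hKub⟩ := iterate_kop_bounded_measurable κ hum hub t
  have hKu0 : ∫ x, (kop κ)^[t] (fun x => f x - a) x ∂π = 0 := by
    rw [integral_iterate_kop κ hπ hum hub t, hu0]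
  have hKui : Integrable ((kop κ)^[t] fun x => f x - a) π := integrable_of_bounded π hKum hKub
  have hgKu : Integrable (fun x => g x * (kop κ)^[t] (fun x => f x - a) x) π :=
    integrable_of_bounded π (hg.mul hKum) (C := Cg * (Cf + |a|)) fun x => by
      rw [abs_mul]
      exact mul_le_mul (hCg x) (hKub x) (abs_nonneg _) ((abs_nonneg _).trans (hCg x))
  -- the covariance is the bilinear form on the centred pair
  have hid : ∫ x, g x * (kop κ)^[t] f x ∂π - b * a
      = ∫ x, (g x - b) * (kop κ)^[t] (fun x => f x - a) x ∂π := by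
    have h1 : (fun x => g x * (kop κ)^[t] f x)
        = fun x => g x * (kop κ)^[t] (fun x => f x - a) x + a * g x := by
      funext x
      rw [hshift]
      ring
    have h2 : (fun x => (g x - b) * (kop κ)^[t] (fun x => f x - a) x)
        = fun x => g x * (kop κ)^[t] (fun x => f x - a) x
            - b * (kop κ)^[t] (fun x => f x - a) x := by
      funext x; ring
    rw [h1, h2, integral_add hgKu (hgi.const_mul a), integral_sub hgKu (hKui.const_mul b),
      integral_const_mul, integral_const_mul, hKu0, ← hb]
    ring
  rw [hid]
  exact abs_integral_mul_iterate_kop_le_of_doeblin hπ hmin hvm hvb hum hub hu0 t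

/-- The cross-covariance envelope with the Doeblin constant written `e^{−M}` (the shape in which the
tree's exact flow-MCMC theorems deliver it, `Exactness/ApproxTrivializingSampler.lean`; `M = 2δ` for
a flow-equation defect `δ`): `|Cov_π(g(X₀), f(X_t))| ≤ (1 − e^{−M})ᵗ σ_π(g) σ_π(f)`. -/
theorem abs_crossCov_le_exp_of_doeblin (hπ : Kernel.Invariant κ π) {M : ℝ}
    (hmin : ∀ x {B : Set Ω}, MeasurableSet B → ENNReal.ofReal (Real.exp (-M)) * π B ≤ κ x B)
    {f g : Ω → ℝ} (hf : Measurable f) {Cf : ℝ} (hCf : ∀ x, |f x| ≤ Cf) (hg : Measurable g)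
    {Cg : ℝ} (hCg : ∀ x, |g x| ≤ Cg) (t : ℕ) :
    |∫ x, g x * (kop κ)^[t] f x ∂π - (∫ x, g x ∂π) * ∫ x, f x ∂π|
      ≤ (1 - Real.exp (-M)) ^ t *
          (Real.sqrt (∫ x, (g x - ∫ y, g y ∂π) ^ 2 ∂π)
            * Real.sqrt (∫ x, (f x - ∫ y, f y ∂π) ^ 2 ∂π)) := by
  have h := abs_crossCov_le_of_doeblin hπ hmin hf hCf hg hCg t
  rwa [ENNReal.toReal_ofReal (Real.exp_pos _).le] at h

end CrossCovariance

end Summit.Ventures.LatticeQCDFlow.Scoring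

end
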